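import Literature.NumberTheory.GaloisRepresentations.GaloisCohomologyCorestriction
import Literature.NumberTheory.GaloisRepresentations.DecompositionGroupRelSlim
import Literature.NumberTheory.GaloisRepresentations.LocalGlobalCohomology
import Literature.NumberTheory.GaloisRepresentations.PadicAlgebraOfLocalField
import HarnessLib

/-!
# Localisation at a finite place as restriction to the decomposition group:
# `Hⁿ(K_v, M) ≃+ Hⁿ(res(Γ_{K_v}), M)` with `loc_v x ↦ res_{D_v} x` (Neukirch II (9.6))

Topic `NumberTheory/GaloisRepresentations`; namespace `Literature.NumberTheory.GaloisRepresentations`.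
Definitions with bodies and theorems; no named fact, no instance.  Companion of
`GaloisCohomologyCorestriction.lean` (the same transport for a FINITE extension `F/K`, where
`res(Γ_F)` is open): for a number field `K` and a finite place `v`, the restriction
`res = absGaloisRestrict K K_v : Γ_{K_v} → Γ_K` is injective (`absGaloisRestrict_adicCompletion_injective`,
Krasner/continuity) with CLOSED image the decomposition group `D_v = D_{𝔓₀}`
(`decompositionSubgroup_adicCompletionPrime_eq_range`), so it is an isomorphism of topological groups
onto its image and transports Galois cohomology:

* `absGaloisRangeEquivCompletion K v : Γ_{K_v} ≃ₜ* res(Γ_{K_v})`;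
* `galoisCohomology.completionRangeTransport ρ v n : Hⁿ(K_v, M) ≃+ Hⁿ(res(Γ_{K_v}), M)`;
* **`completionRangeTransport_localization : T (loc_v x) = res_{res(Γ_{K_v})} x`** — the localisation
  map of the tree (`galoisCohomology.localization ρ (Sum.inr v)`) IS the restriction to the decomposition
  group, read through `T`.

Consumer: the semi-local formula `loc_v ∘ Cor_{K'/K} = Σ_{w∣v} Cor_{K'_w/K_v} ∘ loc_w` (cell `bsd-stepL`,
PT road, binder `hsemi` of `KolyvaginRoadThreePT.middleExact_canonical_of_descentData`), which is the
double-coset formula (`ContinuousCorestrictionDoubleCoset.lean`) for `D = res(Γ_{K_v})`.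

## References
* J. Neukirch, *Algebraic Number Theory* (1999), Ch. II §9 Prop. (9.6). [NeukirchANT1999]
* J.-P. Serre, *Galois Cohomology* (1997), I §2.4, II §6.1. [SerreGaloisCohomology1997]
-/

noncomputable section

open CategoryTheory Function NumberField IsDedekindDomain

universe u

namespace Literature.NumberTheory.GaloisRepresentations

open Field

section Completion

variable (K : Type u) [Field K] [NumberField K] (v : HeightOneSpectrum (𝓞 K))

/-- **`Γ_{K_v} ≃ₜ* res(Γ_{K_v})`**: the restriction to the completion at a finite place, an injective
continuous homomorphism from a compact group (`absGaloisRestrict_adicCompletion_injective`), as an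
isomorphism of topological groups onto its (closed) image `D_v`.
[cite: NeukirchANT1999, Ch. II §9 Prop. (9.6)] -/
def absGaloisRangeEquivCompletion :
    absoluteGaloisGroup (v.adicCompletion K) ≃ₜ* (absGaloisRestrict K (v.adicCompletion K)).range :=
  have hinj : Function.Injective
      ((absGaloisRestrict K (v.adicCompletion K) :
          absoluteGaloisGroup (v.adicCompletion K) →* absoluteGaloisGroup K) :
        absoluteGaloisGroup (v.adicCompletion K) → absoluteGaloisGroup K) :=
    absGaloisRestrict_adicCompletion_injective K v
  haveI : CharZero (v.adicCompletion K) := LocalField.charZero_adicCompletion v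
  { MonoidHom.ofInjective hinj with
    continuous_toFun := (absGaloisRestrict K (v.adicCompletion K)).continuous.subtype_mk _
    continuous_invFun := by
      have hemb : Topology.IsEmbedding (absGaloisRestrict K (v.adicCompletion K)) :=
        ((absGaloisRestrict K (v.adicCompletion K)).continuous.isClosedEmbedding hinj).isEmbedding
      rw [hemb.continuous_iff]
      have h : ((absGaloisRestrict K (v.adicCompletion K) :
            absoluteGaloisGroup (v.adicCompletion K) →* absoluteGaloisGroup K) :
            absoluteGaloisGroup (v.adicCompletion K) → absoluteGaloisGroup K) ∘
          (MonoidHom.ofInjective hinj).invFun = Subtype.val := by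
        funext x
        rw [MulEquiv.invFun_eq_symm]
        exact MonoidHom.apply_ofInjective_symm hinj x
      exact h ▸ continuous_subtype_val }

/-- Unfolding: `absGaloisRangeEquivCompletion K v σ = res σ`. [cite: NeukirchANT1999, Ch. II §9 Prop. (9.6)] -/
@[simp]
theorem absGaloisRangeEquivCompletion_apply_coe (σ : absoluteGaloisGroup (v.adicCompletion K)) :
    ((absGaloisRangeEquivCompletion K v σ : (absGaloisRestrict K (v.adicCompletion K)).range) :
        absoluteGaloisGroup K) = absGaloisRestrict K (v.adicCompletion K) σ :=
  rfl

/-- Unfolding the inverse: `res ((absGaloisRangeEquivCompletion K v).symm h) = h`.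
[cite: NeukirchANT1999, Ch. II §9 Prop. (9.6)] -/
@[simp]
theorem absGaloisRestrict_absGaloisRangeEquivCompletion_symm
    (h : (absGaloisRestrict K (v.adicCompletion K)).range) :
    absGaloisRestrict K (v.adicCompletion K) ((absGaloisRangeEquivCompletion K v).symm h) =
      (h : absoluteGaloisGroup K) :=
  MonoidHom.apply_ofInjective_symm (absGaloisRestrict_adicCompletion_injective K v) h

variable {K} {M : Type u} [AddCommGroup M] [TopologicalSpace M] [DiscreteTopology M]
  (ρ : DiscreteGaloisModule K M)

/-- The module map (identity of `M`) from `Γ_{K_v}` acting through `res` (pulled back along the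
inverse of `absGaloisRangeEquivCompletion`) to the subgroup representation of `res(Γ_{K_v})`.
[cite: SerreGaloisCohomology1997, I §2.4] -/
def completionRangeTransportHom :
    TopRep.res (((absGaloisRangeEquivCompletion K v).symm :
        (absGaloisRestrict K (v.adicCompletion K)).range →ₜ* absoluteGaloisGroup (v.adicCompletion K)) :
        (absGaloisRestrict K (v.adicCompletion K)).range →* absoluteGaloisGroup (v.adicCompletion K))
      (DiscreteGaloisModule.toTopRep (GaloisRep.toLocal v ρ)) ⟶
      subgroupRep ρ.toTopRep (absGaloisRestrict K (v.adicCompletion K)).range :=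
  TopRep.ofHom ⟨ContinuousLinearMap.id ℤ M, fun h => by
    ext m
    change ρ (absGaloisRestrict K (v.adicCompletion K) ((absGaloisRangeEquivCompletion K v).symm h)) m =
      ρ (h : absoluteGaloisGroup K) m
    rw [absGaloisRestrict_absGaloisRangeEquivCompletion_symm]⟩

/-- The module map (identity of `M`) in the other direction. [cite: SerreGaloisCohomology1997, I §2.4] -/
def completionRangeTransportInv :
    TopRep.res (((absGaloisRangeEquivCompletion K v) :
        absoluteGaloisGroup (v.adicCompletion K) →ₜ* (absGaloisRestrict K (v.adicCompletion K)).range) :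
        absoluteGaloisGroup (v.adicCompletion K) →* (absGaloisRestrict K (v.adicCompletion K)).range)
      (subgroupRep ρ.toTopRep (absGaloisRestrict K (v.adicCompletion K)).range) ⟶
      DiscreteGaloisModule.toTopRep (GaloisRep.toLocal v ρ) :=
  TopRep.ofHom ⟨ContinuousLinearMap.id ℤ M, fun _ => rfl⟩

/-- **`Hⁿ(K_v, M) ≃+ Hⁿ(res(Γ_{K_v}), M)`**: local Galois cohomology at the finite place `v` (the
target of `galoisCohomology.localization ρ (Sum.inr v) n`) is the continuous cohomology of the
decomposition group `D_v = res(Γ_{K_v}) ≤ Γ_K`. [cite: SerreGaloisCohomology1997, II §6.1] -/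
def galoisCohomology.completionRangeTransport (n : ℕ) :
    galoisCohomology (GaloisRep.toLocal v ρ) n ≃+
      continuousCohomology n (subgroupRep ρ.toTopRep (absGaloisRestrict K (v.adicCompletion K)).range) :=
  continuousCohomologyAddEquivOfContinuousMulEquiv (absGaloisRangeEquivCompletion K v)
    (completionRangeTransportHom v ρ) (completionRangeTransportInv v ρ) (fun _ => rfl) (fun _ => rfl) n

/-- Unfolding the transport as a `ContinuousCohomology.map`. [cite: SerreGaloisCohomology1997, I §2.4] -/
theorem galoisCohomology.completionRangeTransport_apply (n : ℕ)
    (x : galoisCohomology (GaloisRep.toLocal v ρ) n) :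
    galoisCohomology.completionRangeTransport v ρ n x =
      (ContinuousCohomology.map
        ((absGaloisRangeEquivCompletion K v).symm :
          (absGaloisRestrict K (v.adicCompletion K)).range →ₜ* absoluteGaloisGroup (v.adicCompletion K))
        (completionRangeTransportHom v ρ) n).hom x :=
  rfl

/-- **Localisation is restriction to the decomposition group**: transporting `loc_v x ∈ Hⁿ(K_v, M)`
gives `res_{res(Γ_{K_v})} x` (both are `Hⁿ` of the compatible pair `(res(Γ_{K_v}) ↪ Γ_K, id_M)`).
[cite: NeukirchANT1999, Ch. II §9 Prop. (9.6)] -/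
theorem galoisCohomology.completionRangeTransport_localization (n : ℕ) (x : galoisCohomology ρ n) :
    galoisCohomology.completionRangeTransport v ρ n (galoisCohomology.localization ρ (Sum.inr v) n x) =
      resSubgroup ρ.toTopRep (absGaloisRestrict K (v.adicCompletion K)).range n x := by
  set ψ : (absGaloisRestrict K (v.adicCompletion K)).range →ₜ* absoluteGaloisGroup (v.adicCompletion K) :=
    ((absGaloisRangeEquivCompletion K v).symm :
      (absGaloisRestrict K (v.adicCompletion K)).range →ₜ* absoluteGaloisGroup (v.adicCompletion K)) with hψ
  set f : TopRep.res (absGaloisRestrict K (v.adicCompletion K) :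
      absoluteGaloisGroup (v.adicCompletion K) →* absoluteGaloisGroup K) ρ.toTopRep ⟶
      DiscreteGaloisModule.toTopRep (GaloisRep.toLocal v ρ) :=
    TopRep.ofHom ⟨ContinuousLinearMap.id ℤ M, fun _ => rfl⟩ with hf
  have hcomp := ContinuousCohomology.map_comp (absGaloisRestrict K (v.adicCompletion K)) ψ (X := ρ.toTopRep)
    (Y := DiscreteGaloisModule.toTopRep (GaloisRep.toLocal v ρ))
    (Z := subgroupRep ρ.toTopRep (absGaloisRestrict K (v.adicCompletion K)).range) f
    (completionRangeTransportHom v ρ) n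
  have hφ : (absGaloisRestrict K (v.adicCompletion K)).comp ψ =
      subgroupSubtypeHom (absGaloisRestrict K (v.adicCompletion K)).range := by
    ext h
    change absGaloisRestrict K (v.adicCompletion K) ((absGaloisRangeEquivCompletion K v).symm h) =
      (h : absoluteGaloisGroup K)
    exact absGaloisRestrict_absGaloisRangeEquivCompletion_symm K v h
  have hmap : ContinuousCohomology.map ((absGaloisRestrict K (v.adicCompletion K)).comp ψ) (X := ρ.toTopRep)
      ((TopRep.resFunctor (ψ : (absGaloisRestrict K (v.adicCompletion K)).range →*
          absoluteGaloisGroup (v.adicCompletion K))).map f ≫ completionRangeTransportHom v ρ) n =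
      ContinuousCohomology.map (subgroupSubtypeHom (absGaloisRestrict K (v.adicCompletion K)).range)
        (X := ρ.toTopRep) (Y := subgroupRep ρ.toTopRep (absGaloisRestrict K (v.adicCompletion K)).range)
        (TopRep.ofHom ⟨ContinuousLinearMap.id ℤ M, fun _ => rfl⟩) n :=
    ContinuousCohomology.map_congr_of_eq hφ _ _ (fun _ => rfl) n
  rw [hmap] at hcomp
  exact (congrArg (fun T => TopModuleCat.Hom.hom T x) hcomp).symm

end Completion

end Literature.NumberTheory.GaloisRepresentations

end
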